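import Summits.BirchSwinnertonDyer.Rank1Residual.GaloisImage.PropagatedStructureCartesian
import HarnessLib

/-!
# Route `KimAtThreeKolyvagin` (rung W2), crux `DeepUpperAtThree`: the propagated structure `𝓕_can` is
# CARTESIAN along `E[p^{i+1}] ↪ E[p^{i+c+1}]` for EVERY depth pair (Mazur–Rubin Lemma 3.7.1 /
# Lemma 4.1.1 (i), local half; Sakamoto Def. 3.5 at a general sub-level)

Cell `bsd-addord`, seat `bsd-addord-w2-c3` (D-0074 row B6), item `stmt-BirchSwinnertonDyer-19076`.
TOOL theorem about the local conditions `𝓕_can(E[p^{k+1}])_v = im(H¹(ℚ_v, T_pE) → H¹(ℚ_v, E[p^{k+1}]))`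
(`propagatedSelmerStructure W p k`, n1011-p13) at an arbitrary place `v` of `ℚ`; no definition, no
named fact, no `sorry`; nothing booked.

WHY.  Mazur–Rubin Thm. 4.4.3 in the tree (`KimAtThreeDeepUpperStubLiftable`) consumes the
core-rank-one COUNTS of `H¹_{𝓕(d)}(ℚ, E[p^m])[p^i]` at every depth `i ≤ m`, which come from the
Poitou–Tate counts of `H¹_{𝓕(d)}(ℚ, E[p^i])` (`DeepLedger.natCard_selmerGroup_propagated_atLevel_eq`)
through Lemma 4.1.1 (i): `H¹_{𝓕(d)}(ℚ, E[p^i]) ⥲ H¹_{𝓕(d)}(ℚ, E[p^m])[p^i]` — whose local content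
is that `𝓕_can` is CARTESIAN along the inclusion `E[p^i] ↪ E[p^m]`: a class of `H¹(ℚ_v, E[p^i])`
whose image in `H¹(ℚ_v, E[p^m])` is propagated from `T_pE` is itself propagated from `T_pE`.  The
tree has this for `i = 1` only (n1011-p13 `isCartesianAt_propagatedSelmerStructure`, stated through
the induced structure along `[p^k]`).  This file proves it for every depth pair, by the SAME
cocycle argument (Mazur–Rubin Lemma 3.7.1 "`𝓕_can` is cartesian on quotients of `T`"): if
`incl ∘ ξ = π_{i+c+1} ∘ η + ∂t`, lift `t` to `T_pE` and absorb `∂t̃` into `η`; then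
`π_{i+c+1} ∘ η = incl ∘ ξ` takes values in `E[p^{i+1}]`, so `η ≡ 0 mod p^c`, the shift `η / p^c`
(`tateDivPow c`) is a continuous crossed homomorphism and `π_{i+1} ∘ (η / p^c) = ξ`.  The converse
inclusion `incl_* 𝓕_can(E[p^{i+1}]) ⊆ 𝓕_can(E[p^{i+c+1}])` (`incl ∘ π_{i+1} = p^c π_{i+c+1}`) is the
second theorem.
[cite: MazurRubin2004, Lemma 3.7.1 (p. 33) and Lemma 4.1.1 (i) (p. 35)] [cite: Sakamoto2024, Def. 3.5 (p. 923)]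
[cite: Rubin2011, §3.1 (p. 29)]
-/

set_option autoImplicit false
-- the Theorems namespace of a single-conjunct summit repeats the summit name by design (D-0017)
set_option linter.dupNamespace false

noncomputable section

open scoped Classical NumberField ContRepresentation
open Field NumberField IsDedekindDomain
open WeierstrassCurve Literature.NumberTheory.EllipticCurves Literature.NumberTheory.GaloisRepresentations
  Literature.NumberTheory.GaloisRepresentations.DiscreteGaloisModule
  Summit.BirchSwinnertonDyer.Rank1Residual.GaloisImage

namespace Summit.BirchSwinnertonDyer.BirchSwinnertonDyer.Theorems.KimAtThreeDeepUpperTorsionCartesian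

variable (W : WeierstrassCurve ℚ) [W.IsElliptic] (p : ℕ) [hp : Fact p.Prime] (i c : ℕ) (v : Place ℚ)

omit hp [W.IsElliptic] in
/-- `p^{i+1} ∣ p^{i+c+1}` in `ℤ` in the spelling `p^i · p ∣ p^{i+c} · p` of the torsion levels.
[folklore] -/
theorem pow_mul_dvd_pow_add_mul : ((p : ℤ) ^ i * (p : ℤ)) ∣ ((p : ℤ) ^ (i + c) * (p : ℤ)) :=
  mul_dvd_mul_right (pow_dvd_pow _ (Nat.le_add_right i c)) _

omit hp [W.IsElliptic] in
/-- `incl_* [ξ] = [incl ∘ ξ]` for the inclusion `E[p^{i+1}] ↪ E[p^{i+c+1}]` (the tree's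
`localMap_torsionInclusion_oneCocycleClass`, one parameter up). [folklore] -/
theorem localMap_torsionInclusion_oneCocycleClass_add
    (h : ((p : ℤ) ^ i * (p : ℤ)) ∣ ((p : ℤ) ^ (i + c) * (p : ℤ)))
    (ξ : contOneCocycles ((W.torsionGaloisModule ((p : ℤ) ^ i * (p : ℤ))).toLocal v).toTopRep) :
    DiscreteGaloisModule.localMap (W.torsionInclusion h) v (oneCocycleClass _ ξ) =
      oneCocycleClass _ (contOneCocycles.pullback (ContinuousMonoidHom.id _)
        (X := ((W.torsionGaloisModule ((p : ℤ) ^ i * (p : ℤ))).toLocal v).toTopRep)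
        (Y := ((W.torsionGaloisModule ((p : ℤ) ^ (i + c) * (p : ℤ))).toLocal v).toTopRep)
        (TopRep.ofHom ⟨((W.torsionInclusion h).restrictField (Place.Completion v)).toContinuousLinearMap,
          ((W.torsionInclusion h).restrictField (Place.Completion v)).isIntertwining'⟩) ξ) :=
  galoisCohomology.map_one_oneCocycleClass _ ξ

/-- **`𝓕_can` is cartesian along `E[p^{i+1}] ↪ E[p^{i+c+1}]` at every place** (Mazur–Rubin
Lemma 3.7.1 / Lemma 4.1.1 (i), local half; Sakamoto Def. 3.5 for the sub-level `p^{i+1}`): if the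
image of `x ∈ H¹(ℚ_v, E[p^{i+1}])` in `H¹(ℚ_v, E[p^{i+c+1}])` lies in
`im(H¹(ℚ_v, T_pE) → H¹(ℚ_v, E[p^{i+c+1}]))`, then `x ∈ im(H¹(ℚ_v, T_pE) → H¹(ℚ_v, E[p^{i+1}]))`.
Cocycle proof with the shift `η / p^c` (`tateDivPow`), verbatim n1011-p13's `i = 0` argument one
parameter up; no hypothesis on `v`, on `E(ℚ_v)[p]` or on the reduction type.
[cite: MazurRubin2004, Lemma 3.7.1 (p. 33), Lemma 4.1.1 (i) (p. 35)] [cite: Sakamoto2024, Def. 3.5 (p. 923)] -/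
theorem mem_propagatedSelmerStructure_of_localMap_torsionInclusion_mem
    (h : ((p : ℤ) ^ i * (p : ℤ)) ∣ ((p : ℤ) ^ (i + c) * (p : ℤ)))
    (x : galoisCohomology ((W.torsionGaloisModule ((p : ℤ) ^ i * (p : ℤ))).toLocal v) 1)
    (hx : DiscreteGaloisModule.localMap (W.torsionInclusion h) v x ∈
      propagatedSelmerStructure W p (i + c) v) :
    x ∈ propagatedSelmerStructure W p i v := by
  obtain ⟨ξ, hξ⟩ := oneCocycleClass_surjective
    ((W.torsionGaloisModule ((p : ℤ) ^ i * (p : ℤ))).toLocal v).toTopRep x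
  subst hξ
  obtain ⟨y, hy⟩ := (mem_propagatedSelmerStructure_iff W p (i + c) v _).mp hx
  obtain ⟨η, hη⟩ := oneCocycleClass_surjective (tateLocalRep W p v).toTopRep y
  subst hη
  rw [tateLocalMap_oneCocycleClass, localMap_torsionInclusion_oneCocycleClass_add] at hy
  obtain ⟨t, ht⟩ := exists_sub_eq_of_oneCocycleClass_eq _ _ _ hy
  -- `ht g`, on underlying points: `(η g)_{i+c+1} - ξ g = g t - t`
  have ht' : ∀ g : absoluteGaloisGroup (Place.Completion v),
      TateModule.proj p (i + c + 1) (η.1 g) -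
          ((ξ.1 g : geomTorsion W ((p : ℤ) ^ i * (p : ℤ))) : geomPoints W) =
        absGaloisRestrict ℚ (Place.Completion v) g • (t : geomPoints W) - (t : geomPoints W) := by
    intro g
    exact congrArg (fun P : geomTorsion W ((p : ℤ) ^ (i + c) * (p : ℤ)) => (P : geomPoints W)) (ht g)
  -- lift `t` to `T_pE` and absorb its coboundary into `η`
  obtain ⟨tT, htT⟩ := proj_surjective_of_isAlgClosed_holds W p (i + c + 1)
    ((mem_geomTorsion_pow_mul_iff W p (i + c) _).mp t.2)
  set η' : contOneCocycles (tateLocalRep W p v).toTopRep :=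
    η - principalCocycle _ tT (continuous_tateLocalRep_apply W p v tT) with hη'
  have hη'apply : ∀ g : absoluteGaloisGroup (Place.Completion v),
      η'.1 g = η.1 g - ((tateLocalRep W p v).toTopRep.ρ g tT - tT) := fun g => rfl
  -- `(η' g)_{i+c+1} = ξ g`
  have hkey : ∀ g : absoluteGaloisGroup (Place.Completion v),
      TateModule.proj p (i + c + 1) (η'.1 g) =
        ((ξ.1 g : geomTorsion W ((p : ℤ) ^ i * (p : ℤ))) : geomPoints W) := by
    intro g
    rw [hη'apply, map_sub, map_sub, ContinuousRep.toTopRep_ρ_apply, tateLocalRep_apply_apply,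
      TateModule.proj_smul_of_distribMulAction, htT, ← ht' g]
    abel
  -- hence `(η' g)_c = 0`: `p^{i+1} • (η' g)_{i+c+1} = (η' g)_c` and `ξ g ∈ E[p^{i+1}]`
  have hc0 : ∀ g : absoluteGaloisGroup (Place.Completion v), TateModule.proj p c (η'.1 g) = 0 := by
    intro g
    rw [← TateModule.pow_smul_proj_self_add (i + 1) c (η'.1 g),
      show i + 1 + c = i + c + 1 by ring, hkey]
    have hmem := (ξ.1 g).2
    rw [mem_geomTorsion_iff] at hmem
    have hmem' : ((p ^ (i + 1) : ℕ) : ℤ) •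
        ((ξ.1 g : geomTorsion W ((p : ℤ) ^ i * (p : ℤ))) : geomPoints W) = 0 := by
      have e : ((p ^ (i + 1) : ℕ) : ℤ) = (p : ℤ) ^ i * (p : ℤ) := by push_cast; ring
      rw [e]; exact hmem
    rwa [natCast_zsmul] at hmem'
  -- the divided crossed homomorphism `η'' = η' / p^c`
  let f'' : absoluteGaloisGroup (Place.Completion v) → W.tateModule p :=
    fun g => tateDivPow c (η'.1 g) (hc0 g)
  have hf''val : ∀ (g : absoluteGaloisGroup (Place.Completion v)) (n : ℕ),
      TateModule.proj p n (f'' g) = TateModule.proj p (n + c) (η'.1 g) := fun g n => rfl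
  have hcont'' : Continuous f'' :=
    continuous_induced_rng.2
      (continuous_pi fun n => (TateModule.continuous_proj (n + c)).comp η'.1.continuous)
  have hcoc'' : ∀ g g' : absoluteGaloisGroup (Place.Completion v),
      f'' (g * g') = f'' g + (tateLocalRep W p v).toTopRep.ρ g (f'' g') := by
    intro g g'
    apply TateModule.ext
    intro n
    rw [hf''val, map_add, hf''val, ContinuousRep.toTopRep_ρ_apply, tateLocalRep_apply_apply,
      TateModule.proj_smul_of_distribMulAction, hf''val, η'.2 g g', map_add,
      ContinuousRep.toTopRep_ρ_apply, tateLocalRep_apply_apply,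
      TateModule.proj_smul_of_distribMulAction]
  let η'' : contOneCocycles (tateLocalRep W p v).toTopRep := ⟨⟨f'', hcont''⟩, hcoc''⟩
  have hη''apply : ∀ g : absoluteGaloisGroup (Place.Completion v), η''.1 g = f'' g := fun g => rfl
  -- conclude: `[ξ] = π_{i+1,*} [η'']`
  refine (mem_propagatedSelmerStructure_iff W p i v _).mpr
    ⟨oneCocycleClass (tateLocalRep W p v).toTopRep η'', ?_⟩
  rw [tateLocalMap_oneCocycleClass]
  congr 1
  apply Subtype.ext
  apply ContinuousMap.ext
  intro g
  apply Subtype.ext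
  rw [pushCocycle_apply, coe_tateToTorsion_apply, hη''apply, hf''val, ← hkey g,
    show i + 1 + c = i + c + 1 by ring]

/-- **The converse inclusion: `incl_* 𝓕_can(E[p^{i+1}])_v ⊆ 𝓕_can(E[p^{i+c+1}])_v`**, because
`incl ∘ π_{i+1} = p^c · π_{i+c+1}` on `T_pE` (`a_{i+1} = p^c a_{i+c+1}`), so
`incl_* π_{i+1,*}[η] = π_{i+c+1,*}[p^c η]`. [cite: MazurRubin2004, Lemma 4.1.1 (i) (p. 35)] [cite: Rubin2011, §3.1 (p. 29)] -/
theorem localMap_torsionInclusion_mem_propagatedSelmerStructure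
    (h : ((p : ℤ) ^ i * (p : ℤ)) ∣ ((p : ℤ) ^ (i + c) * (p : ℤ)))
    (x : galoisCohomology ((W.torsionGaloisModule ((p : ℤ) ^ i * (p : ℤ))).toLocal v) 1)
    (hx : x ∈ propagatedSelmerStructure W p i v) :
    DiscreteGaloisModule.localMap (W.torsionInclusion h) v x ∈
      propagatedSelmerStructure W p (i + c) v := by
  obtain ⟨y, rfl⟩ := (mem_propagatedSelmerStructure_iff W p i v x).mp hx
  obtain ⟨η, rfl⟩ := oneCocycleClass_surjective (tateLocalRep W p v).toTopRep y
  refine (mem_propagatedSelmerStructure_iff W p (i + c) v _).mpr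
    ⟨oneCocycleClass (tateLocalRep W p v).toTopRep (((p ^ c : ℕ) : ℤ) • η), ?_⟩
  rw [tateLocalMap_oneCocycleClass, tateLocalMap_oneCocycleClass,
    localMap_torsionInclusion_oneCocycleClass_add]
  congr 1
  apply Subtype.ext
  apply ContinuousMap.ext
  intro g
  apply Subtype.ext
  -- both sides, on underlying points: `p^c • (η g)_{i+c+1}` and `(η g)_{i+1}`
  have hL : ((((pushCocycle W p (i + c) v (((p ^ c : ℕ) : ℤ) • η)).1 g :
      geomTorsion W ((p : ℤ) ^ (i + c) * (p : ℤ))) : geomPoints W)) =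
      TateModule.proj p (i + c + 1) ((((p ^ c : ℕ) : ℤ) • η).1 g) := by
    rw [pushCocycle_apply, coe_tateToTorsion_apply]
  have hsm : (((p ^ c : ℕ) : ℤ) • η).1 g = ((p ^ c : ℕ) : ℤ) • η.1 g := by
    rw [Submodule.coe_smul, ContinuousMap.smul_apply]
  rw [hL, hsm, map_zsmul, natCast_zsmul, show i + c + 1 = c + (i + 1) by ring,
    TateModule.pow_smul_proj_self_add c (i + 1)]
  rfl

end Summit.BirchSwinnertonDyer.BirchSwinnertonDyer.Theorems.KimAtThreeDeepUpperTorsionCartesian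

end
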